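import Literature.NumberTheory.Sieve.LinnikShortIntervalsLemmas
import HarnessLib

/-!
# Linnik–Gallagher: primes `p ≡ a (mod q)` in all short intervals `(x − h, x]`, `h ≥ x^{1−δ}`, `x ≥ C₀ q^L`

Topic `Literature/NumberTheory/Sieve`. THEOREMS only (no definition, no named fact, no `sorry`).
Reproduction of published work: P. X. Gallagher, *A large sieve density estimate near `σ = 1`*,
Invent. Math. 11 (1970), Theorem 7 and its corollary on primes in arithmetic progressions in short
intervals, in Montgomery–Vaughan's form (Acta Arith. 27 (1975), Lemma 4.3 — the tree's
`MontgomeryVaughan1975.lemma43_gallagher_holds`, with `max_{x ≤ N} max_{h ≤ N}` built in), combined with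
Siegel's theorem at exponent `ε` for the exceptional zero: **for every `ε > 0` there are `L, δ, C₀, c > 0`
such that for all `q ≥ 1`, `(a, q) = 1`, all naturals `x ≥ C₀ q^L` and `x^{1−δ} ≤ h ≤ x`,
`∑_{x−h < p ≤ x, p ≡ a (q)} log p ≥ c h/(φ(q) q^ε)`** — in particular such intervals contain primes
`≡ a (mod q)`.  This contains both Linnik's theorem (`LinnikLeastPrimeAP.lean`, `LinnikLowerBound.lean`:
`h = x`) and Hoheisel's theorem (`HoheiselPrimesShortIntervals.lean`: `q = 1`).

Proof: the window lemmas of `LinnikShortIntervalsLemmas.lean` (orthogonality for the class `a` on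
`(x − h, x]`, passage to primitive characters at cost `φ(q) log q`, at most one character mod `q` induced
by the exceptional `χ̃`, and then `r̃ ∣ q`); the main term in the exceptional case is
`h − χ̃(a)∑_{x−h<n≤x} n^{β̃−1} ≥ h(1 − (x/2)^{β̃−1}) ≥ h·min(1/2, (1 − β̃) log(x/2)/2)` for `h ≤ x/2`,
with `1 − β̃ ≥ C(ε) q^{−ε}` (Siegel) unless `1 − β̃ ≥ c/log P` (Landau–Page), which is excluded in the
delicate case once `A ≥ 2/c + 2`.

* `Linnik.totient_mul_thetaWindow_ge_of_lemma43` — window form from `lemma43_gallagher`;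
* `Literature.NumberTheory.Sieve.linnik_gallagher_shortInterval` — the theorem, unconditional.

## References

* [Gallagher1970Density] P. X. Gallagher, Invent. Math. 11 (1970) 329–339, Theorem 7.
* [MontgomeryVaughanActa1975] H. L. Montgomery, R. C. Vaughan, Acta Arith. 27 (1975), §4 Lemma 4.3.
* [Linnik1944] Yu. V. Linnik, Mat. Sb. 15 (57) (1944). [Hoheisel1930] G. Hoheisel (1930).
-/

noncomputable section

open Finset Real

namespace Literature.NumberTheory.Sieve

namespace Linnik

open MontgomeryVaughan1975 PrimesInAPGallagher Literature.NumberTheory.LFunctions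

set_option maxHeartbeats 800000 in
open scoped Classical in
/-- **`φ(q)·(θ(x;q,a) − θ(x−h;q,a)) ≥ c(ε) h/q^ε` on windows** `(x − h, x]` with `x ≤ N`, `2h ≤ x`,
`N/P ≤ h`, for `P ≥ max(q, P₀(ε))`, `P^A ≤ N`, `log N ≤ (log P)²` — from `lemma43_gallagher` and Siegel's
theorem at exponent `ε` (`0 < ε ≤ 1`). [cite: Gallagher1970Density, Theorem 7]
[cite: MontgomeryVaughanActa1975, §4 Lemma 4.3] -/
theorem totient_mul_thetaWindow_ge_of_lemma43 (h43 : lemma43_gallagher) {ε : ℝ} (hε : 0 < ε)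
    (hε1 : ε ≤ 1) :
    ∃ A : ℝ, 1 ≤ A ∧ ∃ P₀ : ℝ, Real.exp (A + 1) ≤ P₀ ∧ ∃ c : ℝ, 0 < c ∧
      ∀ (q : ℕ) [NeZero q] (a : ZMod q), IsUnit a →
      ∀ P : ℝ, P₀ ≤ P → (q : ℝ) ≤ P → ∀ N : ℕ, P ^ A ≤ (N : ℝ) → Real.log N ≤ Real.log P ^ 2 →
      ∀ x h : ℕ, x ≤ N → 2 * (h : ℝ) ≤ x → (N : ℝ) / P ≤ h →
        c * h / (q : ℝ) ^ ε ≤ (q.totient : ℝ) *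
          ∑ p ∈ ((Ioc (x - h) x).filter Nat.Prime).filter (fun p : ℕ => (p : ZMod q) = a),
            Real.log p := by
  obtain ⟨c₁, hc₁, c₃, hc₃, c₄, hc₄, K, hK, hGal⟩ := sum_norm_gallagherTerm_le_or_window h43
  obtain ⟨cU, hcU, hU⟩ := exists_exceptionalZero_unique
  obtain ⟨C_S, hC_S, hSiegel⟩ := Siegel.exists_one_sub_realZero_ge (ε := ε) hε
  -- constants
  set c₁' : ℝ := max c₁ 1 with hc₁'
  have hc₁'1 : 1 ≤ c₁' := le_max_right _ _
  have hc₁c₁' : c₁ ≤ c₁' := le_max_left _ _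
  have hK0 : 0 < K := by linarith
  set A : ℝ := max (max 5 (1 / c₄)) (max (Real.log (64 * K * c₁') / c₃ + 1) (2 / cU + 2)) with hA
  have hA5 : 5 ≤ A := (le_max_left _ _).trans' (le_max_left _ _)
  have hAc₄ : 1 / c₄ ≤ A := (le_max_left _ _).trans' (le_max_right _ _)
  have hAK : Real.log (64 * K * c₁') / c₃ ≤ A := by
    have := (le_max_right (max 5 (1 / c₄)) _).trans' (le_max_left (Real.log (64 * K * c₁') / c₃ + 1)
      (2 / cU + 2))
    linarith
  have hAU : 2 / cU + 2 ≤ A := (le_max_right _ _).trans' (le_max_right _ _)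
  have hA1 : 1 ≤ A := by linarith
  set P₀ : ℝ := max (max (Real.exp (A + 1)) (Real.exp (4 * c₁' + 16)))
    (16 / (C_S * Real.log 2) + 16) with hP₀
  have hP₀exp : Real.exp (A + 1) ≤ P₀ := (le_max_left _ _).trans' (le_max_left _ _)
  have hP₀c : Real.exp (4 * c₁' + 16) ≤ P₀ := (le_max_left _ _).trans' (le_max_right _ _)
  have hP₀C : 16 / (C_S * Real.log 2) + 16 ≤ P₀ := le_max_right _ _
  have hP₀16 : 16 ≤ P₀ := by
    have : 0 ≤ 16 / (C_S * Real.log 2) := by positivity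
    linarith
  refine ⟨A, hA1, P₀, hP₀exp, min (1 / 4) (C_S * Real.log 2 / 16), by positivity,
    fun q _ a ha P hP hqP N hN1 hlogN2 x h hxN h2x hNPh => ?_⟩
  -- sizes
  have hP16 : 16 ≤ P := hP₀16.trans hP
  have hP1 : 1 < P := by linarith
  have hP0 : 0 < P := by linarith
  have hlogP : 0 < Real.log P := Real.log_pos hP1
  have hlog2 : 0 < Real.log 2 := Real.log_pos (by norm_num)
  have hlogP2 : Real.log 2 ≤ Real.log P := Real.log_le_log (by norm_num) (by linarith)
  have hlogPA : A + 1 ≤ Real.log P := by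
    rw [← Real.log_exp (A + 1)]; exact Real.log_le_log (Real.exp_pos _) (hP₀exp.trans hP)
  have hlogPc : 4 * c₁' + 16 ≤ Real.log P := by
    rw [← Real.log_exp (4 * c₁' + 16)]; exact Real.log_le_log (Real.exp_pos _) (hP₀c.trans hP)
  have hPA1 : 1 ≤ P ^ A := Real.one_le_rpow hP1.le (by linarith)
  have hN1' : (1 : ℝ) ≤ N := hPA1.trans hN1
  have hN0 : (0 : ℝ) < N := by linarith
  have hNnat : 1 ≤ N := by exact_mod_cast hN1'
  have hlogN : A * Real.log P ≤ Real.log N := by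
    rw [← Real.log_rpow hP0]; exact Real.log_le_log (by positivity) hN1
  have hq1 : (1 : ℝ) ≤ q := by exact_mod_cast Nat.pos_of_neZero q
  have hq0 : (0 : ℝ) < q := by linarith
  have hqε0 : 0 < (q : ℝ) ^ ε := Real.rpow_pos_of_pos hq0 _
  have hqε1 : 1 ≤ (q : ℝ) ^ ε := Real.one_le_rpow hq1 hε.le
  have hqεP : (q : ℝ) ^ ε ≤ P := by
    have h1 : (q : ℝ) ^ ε ≤ (q : ℝ) ^ (1 : ℝ) := Real.rpow_le_rpow_of_exponent_le hq1 hε1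
    rw [Real.rpow_one] at h1
    exact h1.trans hqP
  -- `h ≥ N/P ≥ P^{A−1} ≥ 16 P²`, `x/2 ≥ h`, `log(x/2) ≥ (A−1) log P`
  have hPA' : P ^ A / P = P ^ (A - 1) := by
    rw [Real.rpow_sub hP0, Real.rpow_one]
  have hhP : P ^ (A - 1) ≤ (h : ℝ) := by
    rw [← hPA']; exact (div_le_div_of_nonneg_right hN1 hP0.le).trans hNPh
  have hP3h : 16 * P ^ 2 ≤ (h : ℝ) := by
    have h1 : 16 * P ^ 2 ≤ P ^ (3 : ℝ) := by
      rw [show (3 : ℝ) = (3 : ℕ) by norm_num, Real.rpow_natCast]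
      have := mul_le_mul_of_nonneg_right hP16 (sq_nonneg P)
      calc 16 * P ^ 2 ≤ P * P ^ 2 := this
        _ = P ^ 3 := by ring
    have h2 : P ^ (3 : ℝ) ≤ P ^ (A - 1) := Real.rpow_le_rpow_of_exponent_le hP1.le (by linarith)
    linarith
  have hP2 : (256 : ℝ) ≤ P ^ 2 := by
    have := mul_le_mul hP16 hP16 (by norm_num) (by linarith)
    calc (256 : ℝ) = 16 * 16 := by norm_num
      _ ≤ P * P := this
      _ = P ^ 2 := by ring
  have hh0 : (0 : ℝ) < h := by linarith only [hP3h, hP2]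
  have hx2h : (h : ℝ) ≤ (x : ℝ) / 2 := by linarith
  have hx20 : (0 : ℝ) < (x : ℝ) / 2 := by linarith
  have hlogx2 : (A - 1) * Real.log P ≤ Real.log ((x : ℝ) / 2) := by
    rw [← Real.log_rpow hP0]
    exact Real.log_le_log (by positivity) (hhP.trans hx2h)
  have hhx : h ≤ x := by
    have : (h : ℝ) ≤ x := by linarith
    exact_mod_cast this
  have hhN : h ≤ N := hhx.trans hxN
  -- the range of Lemma 4.3
  have hrange1 : Real.exp (Real.sqrt (Real.log N)) ≤ P := by
    rw [← Real.exp_log hP0, Real.exp_le_exp]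
    exact Real.sqrt_le_iff.mpr ⟨hlogP.le, hlogN2⟩
  have hrange2 : P ≤ (N : ℝ) ^ c₄ := by
    have h1 : P ≤ (P ^ A) ^ c₄ := by
      rw [← Real.rpow_mul hP0.le]
      have : 1 ≤ A * c₄ := by
        rw [div_le_iff₀ hc₄] at hAc₄; linarith
      calc P = P ^ (1 : ℝ) := (Real.rpow_one P).symm
        _ ≤ P ^ (A * c₄) := Real.rpow_le_rpow_of_exponent_le hP1.le this
    exact h1.trans (Real.rpow_le_rpow (by positivity) hN1 hc₄.le)
  -- `E ≤ e^{−c₃ A} ≤ 1/(64 K c₁')`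
  set E : ℝ := Real.exp (-c₃ * Real.log N / Real.log P) with hE
  have hE0 : 0 < E := Real.exp_pos _
  have hEK : E * (64 * K * c₁') ≤ 1 := by
    have h1 : E ≤ Real.exp (-c₃ * A) := by
      rw [hE, Real.exp_le_exp]
      have : c₃ * A ≤ c₃ * Real.log N / Real.log P := by
        rw [le_div_iff₀ hlogP]
        have := mul_le_mul_of_nonneg_left hlogN hc₃.le
        linarith
      have e : -c₃ * Real.log N / Real.log P = -(c₃ * Real.log N / Real.log P) := by ring
      linarith
    have h2 : Real.exp (-c₃ * A) * (64 * K * c₁') ≤ 1 := by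
      have h3 : Real.log (64 * K * c₁') ≤ c₃ * A := by rw [div_le_iff₀ hc₃] at hAK; linarith
      have h4 : 64 * K * c₁' ≤ Real.exp (c₃ * A) := by
        calc 64 * K * c₁' = Real.exp (Real.log (64 * K * c₁')) := (Real.exp_log (by positivity)).symm
          _ ≤ Real.exp (c₃ * A) := Real.exp_le_exp.mpr h3
      have h5 : Real.exp (-c₃ * A) * Real.exp (c₃ * A) = 1 := by
        rw [← Real.exp_add]; simp
      calc Real.exp (-c₃ * A) * (64 * K * c₁') ≤ Real.exp (-c₃ * A) * Real.exp (c₃ * A) :=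
            mul_le_mul_of_nonneg_left h4 (Real.exp_pos _).le
        _ = 1 := h5
    exact (mul_le_mul_of_nonneg_right h1 (by positivity)).trans h2
  -- `(h + N/P) ≤ 2h`
  have hhNP : (h : ℝ) + N / P ≤ 2 * h := by linarith
  -- `φ(q) log q ≤ P²`
  have hφ : (q.totient : ℝ) * Real.log q ≤ P ^ 2 := by
    have h1 : (q.totient : ℝ) ≤ q := by exact_mod_cast Nat.totient_le q
    have h2 : Real.log q ≤ q := (Real.log_le_sub_one_of_pos (by linarith)).trans (by linarith)
    have h3 : Real.log q ≥ 0 := Real.log_nonneg hq1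
    calc (q.totient : ℝ) * Real.log q ≤ q * q := mul_le_mul h1 h2 h3 (by linarith)
      _ ≤ P * P := mul_le_mul hqP hqP (by linarith) hP0.le
      _ = P ^ 2 := by ring
  -- the size of the claimed lower bound
  have hcN : min (1 / 4) (C_S * Real.log 2 / 16) * h / (q : ℝ) ^ ε ≤ (h : ℝ) / 4 := by
    rw [div_le_iff₀ hqε0]
    have h1 : min (1 / 4) (C_S * Real.log 2 / 16) * (h : ℝ) ≤ 1 / 4 * h :=
      mul_le_mul_of_nonneg_right (min_le_left _ _) hh0.le
    have h2 : 1 / 4 * (h : ℝ) ≤ h / 4 * (q : ℝ) ^ ε := by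
      have := mul_le_mul_of_nonneg_left hqε1 (show 0 ≤ (h : ℝ) / 4 by positivity)
      linarith
    linarith
  have hcN' : min (1 / 4) (C_S * Real.log 2 / 16) * h / (q : ℝ) ^ ε ≤
      C_S * Real.log 2 / 16 * h / (q : ℝ) ^ ε :=
    div_le_div_of_nonneg_right (mul_le_mul_of_nonneg_right (min_le_right _ _) hh0.le) hqε0.le
  rcases hGal N P hNnat hrange1 hrange2 hP1.le x h hxN hhN q hqP with
    ⟨-, hAsum⟩ | ⟨r, hr, χe, β, hexc, hBsum⟩
  · -- no exceptional zero
    have hθ := totient_mul_thetaWindow_ge_exc ha hhx (r := 0) (1 : DirichletCharacter ℂ 0) 1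
    rw [sum_inducedBy_zero_eq_zero a (1 : DirichletCharacter ℂ 0), Complex.zero_re, zero_mul,
      sub_zero] at hθ
    simp only [gallagherTermExc_zero_eq] at hθ
    have h1 : ∑ χ : DirichletCharacter ℂ q, ‖gallagherTerm χ.primitiveCharacter x h‖ ≤ h / 16 := by
      refine hAsum.trans ?_
      have e : (2 * (h : ℝ)) * K * E = (h / 32) * (E * (64 * K * 1)) := by ring
      have hE1 : E * (64 * K * 1) ≤ 1 :=
        le_trans (mul_le_mul_of_nonneg_left (by
          have := mul_le_mul_of_nonneg_left hc₁'1 (show (0:ℝ) ≤ 64 * K by positivity)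
          linarith) hE0.le) hEK
      calc ((h : ℝ) + N / P) * K * E ≤ (2 * h) * K * E := by gcongr
        _ = (h / 32) * (E * (64 * K * 1)) := e
        _ ≤ h / 32 := mul_le_of_le_one_right (by positivity) hE1
        _ ≤ h / 16 := by linarith
    exact hcN.trans (by linarith only [hθ, h1, hφ, hP3h, hh0])
  · -- the exceptional zero `β` of `χ̃` mod `r` occurs
    haveI := hr
    obtain ⟨hprim, hne1, hrP, hβlow, hβ1, hLβ⟩ := hexc
    have hθ := totient_mul_thetaWindow_ge_exc ha hhx χe β
    have hr' := abs_re_sum_inducedBy_le_one a χe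
    have hβ34 : 3 / 4 ≤ β := by
      have h1 : c₁ / Real.log P ≤ 1 / 4 := by
        rw [div_le_iff₀ hlogP]; linarith
      linarith
    have hβ0 : 0 < β := by linarith
    have hδ0 : 0 < 1 - β := by linarith
    have hδc₁ : (1 - β) * Real.log P ≤ c₁' := by
      have h1 : 1 - β ≤ c₁ / Real.log P := by linarith
      calc (1 - β) * Real.log P ≤ c₁ / Real.log P * Real.log P :=
            mul_le_mul_of_nonneg_right h1 hlogP.le
        _ = c₁ := div_mul_cancel₀ c₁ hlogP.ne'
        _ ≤ c₁' := hc₁c₁'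
    -- the error from Lemma 4.3: `≤ (h/32) X/c₁' ≤ h/32`
    have hc₁'0 : c₁' ≠ 0 := by positivity
    set X : ℝ := (1 - β) * Real.log P with hX
    have hX0 : 0 < X := mul_pos hδ0 hlogP
    have herr : ∑ χ : DirichletCharacter ℂ q, ‖gallagherTermExc χe β χ.primitiveCharacter x h‖ ≤
        h / 32 * X / c₁' := by
      refine hBsum.trans ?_
      have e : (2 * (h : ℝ)) * K * X * E = h / 32 * X / c₁' * (E * (64 * K * c₁')) := by
        field_simp; ring
      calc ((h : ℝ) + N / P) * K * X * E ≤ (2 * h) * K * X * E := by gcongr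
        _ = h / 32 * X / c₁' * (E * (64 * K * c₁')) := e
        _ ≤ h / 32 * X / c₁' := mul_le_of_le_one_right (by positivity) hEK
    have herr' : ∑ χ : DirichletCharacter ℂ q, ‖gallagherTermExc χe β χ.primitiveCharacter x h‖ ≤
        h / 32 := by
      refine herr.trans ?_
      rw [div_le_iff₀ (by positivity)]
      exact mul_le_mul_of_nonneg_left hδc₁ (by positivity)
    -- is some character mod `q` induced by `χ̃`?
    by_cases hind : ((univ : Finset (DirichletCharacter ℂ q)).filter (fun χ =>
        χ.conductor = r ∧ ∀ n : ℕ, χ.primitiveCharacter (n : ZMod χ.conductor) = χe (n : ZMod r))).Nonempty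
    swap
    · rw [Finset.not_nonempty_iff_eq_empty] at hind
      rw [hind, Finset.sum_empty, Complex.zero_re, zero_mul, sub_zero] at hθ
      exact hcN.trans (by linarith only [hθ, herr', hφ, hP3h, hh0])
    obtain ⟨χ₀, hχ₀⟩ := hind
    rw [Finset.mem_filter] at hχ₀
    have hrq : (r : ℝ) ≤ q := by
      have h1 : r ∣ q := hχ₀.2.1 ▸ χ₀.conductor_dvd_level
      exact_mod_cast Nat.le_of_dvd (Nat.pos_of_neZero q) h1
    have hr0 : (0 : ℝ) < r := by exact_mod_cast Nat.pos_of_neZero r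
    obtain ⟨r', hr'def⟩ : ∃ r' : ℝ, r' = (∑ χ ∈ (univ : Finset (DirichletCharacter ℂ q)).filter
        (fun χ => χ.conductor = r ∧
          ∀ n : ℕ, χ.primitiveCharacter (n : ZMod χ.conductor) = χe (n : ZMod r)), χ a⁻¹).re :=
      ⟨_, rfl⟩
    obtain ⟨S, hS⟩ : ∃ S : ℝ, S = ∑ n ∈ Ioc (x - h) x, (n : ℝ) ^ (β - 1) := ⟨_, rfl⟩
    rw [← hr'def, ← hS] at hθ
    rw [← hr'def] at hr'
    -- the main term: `h − r' S ≥ h (1 − (x/2)^{β−1}) ≥ h · min(1/2, t/2)`, `t = (1 − β) log(x/2)`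
    have hSle : S ≤ (h : ℝ) * ((x : ℝ) / 2) ^ (β - 1) := hS ▸ sum_Ioc_rpow_le_mul h2x hβ1.le
    have hS0 : 0 ≤ S := hS ▸ Finset.sum_nonneg fun n _ => Real.rpow_nonneg (Nat.cast_nonneg n) _
    set t : ℝ := (1 - β) * Real.log ((x : ℝ) / 2) with ht
    have hAlogP : 0 ≤ (A - 1) * Real.log P := mul_nonneg (by linarith) hlogP.le
    have ht0 : 0 ≤ t := mul_nonneg hδ0.le (le_trans hAlogP hlogx2)
    have hpow : ((x : ℝ) / 2) ^ (β - 1) = Real.exp (-t) := by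
      rw [Real.rpow_def_of_pos hx20, ht]; congr 1; ring
    have hmain : (h : ℝ) * min (1 / 2) (t / 2) ≤ h - r' * S := by
      have h1 : r' * S ≤ S := by
        have := mul_le_mul_of_nonneg_right (abs_le.mp hr').2 hS0
        linarith only [this]
      have h2 : (h : ℝ) * (1 - Real.exp (-t)) ≤ h - S := by
        rw [← hpow]
        have e : (h : ℝ) * (1 - ((x : ℝ) / 2) ^ (β - 1)) = h - h * ((x : ℝ) / 2) ^ (β - 1) := by ring
        linarith only [e, hSle]
      have h3 := mul_le_mul_of_nonneg_left (min_half_le_one_sub_exp_neg ht0) hh0.le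
      linarith only [h1, h2, h3]
    rcases le_or_gt 1 t with hB1 | hB2
    · -- `t ≥ 1`: main term `≥ h/2`
      have hm : (h : ℝ) / 2 ≤ h - r' * S := by
        rw [min_eq_left (by linarith : (1:ℝ) / 2 ≤ t / 2)] at hmain; linarith
      exact hcN.trans (by linarith only [hθ, hm, herr', hφ, hP3h, hh0])
    · -- `t < 1`: Landau–Page is excluded (`A ≥ 2/c_U + 2`), so `χ̃` is quadratic and Siegel applies
      have hm : (h : ℝ) * (t / 2) ≤ h - r' * S := by
        rw [min_eq_right (by linarith : t / 2 ≤ (1:ℝ) / 2)] at hmain; exact hmain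
      have hβU : 1 - cU / Real.log P < β := by
        by_contra hcon
        push Not at hcon
        have h1 : cU / Real.log P ≤ 1 - β := by linarith
        have h2 : cU / Real.log P * Real.log ((x : ℝ) / 2) ≤ t :=
          mul_le_mul_of_nonneg_right h1 (le_trans hAlogP hlogx2)
        have h3 : cU * (A - 1) ≤ cU / Real.log P * Real.log ((x : ℝ) / 2) := by
          rw [div_mul_eq_mul_div, le_div_iff₀ hlogP]
          have := mul_le_mul_of_nonneg_left hlogx2 hcU.le
          linarith
        have h4 : 1 ≤ cU * (A - 1) := by
          have := mul_le_mul_of_nonneg_left hAU hcU.le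
          have e : cU * (2 / cU + 2) = 2 + 2 * cU := by field_simp
          have e2 : cU * (A - 1) = cU * A - cU := by ring
          linarith only [this, e, e2, hcU]
        linarith only [h2, h3, h4, hB2]
      have hsq : χe ^ 2 = 1 :=
        ((hU P (by linarith)).1 r χe hne1 hrP (β : ℂ) hLβ
          (by rw [Complex.ofReal_im, abs_zero]; linarith) (by rw [Complex.ofReal_re]; exact hβU)).1
      have hSg := hSiegel r χe hsq hne1 β hLβ
      have hδlow : C_S / (q : ℝ) ^ ε ≤ 1 - β := by
        have hrq' : (r : ℝ) ^ (-ε) ≥ (q : ℝ) ^ (-ε) := Real.rpow_le_rpow_of_nonpos hr0 hrq (by linarith)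
        calc C_S / (q : ℝ) ^ ε = C_S * (q : ℝ) ^ (-ε) := by rw [Real.rpow_neg hq0.le, div_eq_mul_inv]
          _ ≤ C_S * (r : ℝ) ^ (-ε) := mul_le_mul_of_nonneg_left hrq' hC_S.le
          _ ≤ 1 - β := hSg
      -- `t ≥ (A−1) X ≥ 4 X` and `X ≥ C_S log 2 / q^ε ≥ C_S log 2 / P`
      have htX : (A - 1) * X ≤ t := by
        rw [hX, ht]
        have := mul_le_mul_of_nonneg_left hlogx2 hδ0.le
        linarith
      have hXε : C_S * Real.log 2 / (q : ℝ) ^ ε ≤ X := by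
        rw [hX]
        calc C_S * Real.log 2 / (q : ℝ) ^ ε = C_S / (q : ℝ) ^ ε * Real.log 2 := by ring
          _ ≤ (1 - β) * Real.log P := mul_le_mul hδlow hlogP2 hlog2.le hδ0.le
      have hX1 : C_S * Real.log 2 / P ≤ X :=
        (div_le_div_of_nonneg_left (mul_nonneg hC_S.le hlog2.le) hqε0 hqεP).trans hXε
      -- error: `h X/32 ≤ h (A−1) X / 16 ≤ h t/16`... we use `herr ≤ h/32 · X/c₁' ≤ h X/32 ≤ h t/8`
      have herrX : ∑ χ : DirichletCharacter ℂ q, ‖gallagherTermExc χe β χ.primitiveCharacter x h‖ ≤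
          h * t / 8 := by
        refine herr.trans ?_
        have h1 : (h : ℝ) / 32 * X / c₁' ≤ h / 32 * X := div_le_self (by positivity) hc₁'1
        have h2 : (h : ℝ) / 32 * X ≤ h * t / 8 := by
          have hXt : X ≤ t := by
            have := mul_le_mul_of_nonneg_right (show (1:ℝ) ≤ A - 1 by linarith) hX0.le
            linarith only [this, htX]
          have := mul_le_mul_of_nonneg_left hXt hh0.le
          have hht : 0 ≤ (h : ℝ) * t := mul_nonneg hh0.le ht0
          linarith only [this, hht]
        exact h1.trans h2
      -- `P² ≤ h t/8`: `h t ≥ P^{A−1} · 4 · C_S log 2/P ≥ 4 C_S log 2 · P³ ≥ 8 P²` when `P ≥ 16/(C_S log 2)`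
      have hkey : P ^ 2 ≤ (h : ℝ) * t / 8 := by
        have hPC : 16 / (C_S * Real.log 2) ≤ P := by linarith
        have hPC' : 16 ≤ P * (C_S * Real.log 2) := by
          rwa [div_le_iff₀ (by positivity)] at hPC
        have hA4X : 4 * X ≤ t := by
          have := mul_le_mul_of_nonneg_right (show (4:ℝ) ≤ A - 1 by linarith) hX0.le
          linarith only [this, htX]
        have h1 : P ^ (A - 1) * (4 * (C_S * Real.log 2 / P)) ≤ (h : ℝ) * t :=
          mul_le_mul hhP (by linarith only [hX1, hA4X]) (by positivity) hh0.le
        have hP4 : P ^ 4 ≤ P ^ (A - 1) := by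
          have : P ^ (4 : ℝ) ≤ P ^ (A - 1) := Real.rpow_le_rpow_of_exponent_le hP1.le (by linarith)
          rwa [show (4 : ℝ) = (4 : ℕ) by norm_num, Real.rpow_natCast] at this
        have h2 : P ^ 4 * (4 * (C_S * Real.log 2 / P)) ≤ (h : ℝ) * t :=
          (mul_le_mul_of_nonneg_right hP4 (by positivity)).trans h1
        have e2 : P ^ 4 * (4 * (C_S * Real.log 2 / P)) = 4 * P ^ 2 * (P * (C_S * Real.log 2)) := by
          field_simp
        rw [e2] at h2
        have h3 : 4 * P ^ 2 * 16 ≤ 4 * P ^ 2 * (P * (C_S * Real.log 2)) :=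
          mul_le_mul_of_nonneg_left hPC' (by positivity)
        linarith only [h2, h3, hP2]
      -- conclusion: `φ Θ ≥ h t/2 − h t/8 − h t/8 = h t/4 ≥ h (A−1) X/4 ≥ h X ≥ (C_S log 2) h/q^ε`
      have h5 : (h : ℝ) * (C_S * Real.log 2 / (q : ℝ) ^ ε) ≤ h * X :=
        mul_le_mul_of_nonneg_left hXε hh0.le
      have e5 : C_S * Real.log 2 / 16 * (h : ℝ) / (q : ℝ) ^ ε = h * (C_S * Real.log 2 / (q : ℝ) ^ ε) / 16 := by
        field_simp
      refine hcN'.trans ?_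
      rw [e5]
      have hA4X : 4 * X ≤ t := by
        have := mul_le_mul_of_nonneg_right (show (4:ℝ) ≤ A - 1 by linarith) hX0.le
        linarith only [this, htX]
      have h6 : (h : ℝ) * (4 * X) ≤ h * t := mul_le_mul_of_nonneg_left hA4X hh0.le
      have h7 : 0 ≤ (h : ℝ) * (C_S * Real.log 2 / (q : ℝ) ^ ε) := by positivity
      linarith only [hθ, hm, herrX, hφ, hkey, h5, h6, h7]

end Linnik

set_option maxHeartbeats 800000 in
open MontgomeryVaughan1975 in
/-- **LINNIK–GALLAGHER: primes in arithmetic progressions in all short intervals**, unconditional: for every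
`ε > 0` there are `L, δ, C₀, c > 0` such that for all `q ≥ 1`, all `a` coprime to `q`, all naturals
`x ≥ C₀ q^L` and all `h` with `x^{1−δ} ≤ h ≤ x`:
`∑_{x−h < p ≤ x prime, p ≡ a (mod q)} log p ≥ c · h/(φ(q) q^ε)`.  (For `h ≤ x/2` this is the window
theorem with `N = x` and `P = max(q, P₀)` or `exp(√(log x))`; for `h > x/2` shrink the window to
`h' = ⌊x/2⌋`.)  Contains Linnik's theorem (`h = x`) and Hoheisel's theorem (`q = 1`).
[cite: Gallagher1970Density, Theorem 7] [cite: MontgomeryVaughanActa1975, §4 Lemma 4.3] -/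
theorem linnik_gallagher_shortInterval {ε : ℝ} (hε : 0 < ε) :
    ∃ L δ C₀ c : ℝ, 0 < L ∧ 0 < δ ∧ 0 < C₀ ∧ 0 < c ∧ ∀ q : ℕ, 1 ≤ q → ∀ a : ℕ, a.Coprime q →
      ∀ x h : ℕ, C₀ * (q : ℝ) ^ L ≤ x → (x : ℝ) ^ (1 - δ) ≤ h → h ≤ x →
        c * h / (q.totient * (q : ℝ) ^ ε) ≤
          ∑ p ∈ ((Ioc (x - h) x).filter Nat.Prime).filter (fun p : ℕ => p ≡ a [MOD q]), Real.log p := by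
  classical
  set ε' : ℝ := min ε 1 with hε'
  have hε'0 : 0 < ε' := lt_min hε one_pos
  have hε'1 : ε' ≤ 1 := min_le_right _ _
  have hε'ε : ε' ≤ ε := min_le_left _ _
  obtain ⟨A, hA1, P₀, hP₀exp, c, hc, hW⟩ :=
    Linnik.totient_mul_thetaWindow_ge_of_lemma43 lemma43_gallagher_holds hε'0 hε'1
  have hP₀1 : 1 ≤ P₀ := le_trans (by have := Real.add_one_le_exp (A + 1); linarith) hP₀exp
  have hP₀0 : 0 < P₀ := by linarith
  -- `L = A`, `δ = 1/A`, `C₀ = 8 P₀^A`, constant `c/3`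
  refine ⟨A, 1 / A, 8 * P₀ ^ A, c / 3, by linarith, by positivity, by positivity, by positivity,
    fun q hq a haq x h hx hxh hhx => ?_⟩
  haveI : NeZero q := ⟨by omega⟩
  have hq1 : (1 : ℝ) ≤ q := by exact_mod_cast hq
  have hq0 : (0 : ℝ) < q := by linarith
  have hP₀A : 1 ≤ P₀ ^ A := Real.one_le_rpow hP₀1 (by linarith)
  have hqA1 : 1 ≤ (q : ℝ) ^ A := Real.one_le_rpow hq1 (by linarith)
  have hx8 : 8 * (P₀ ^ A * (q : ℝ) ^ A) ≤ x := by
    have e : 8 * P₀ ^ A * (q : ℝ) ^ A = 8 * (P₀ ^ A * (q : ℝ) ^ A) := by ring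
    linarith only [hx, e]
  have hx8' : (8 : ℝ) ≤ x := by
    have : (1 : ℝ) ≤ P₀ ^ A * (q : ℝ) ^ A := one_le_mul_of_one_le_of_one_le hP₀A hqA1
    linarith
  have hx0 : (0 : ℝ) < x := by linarith
  have ha : IsUnit (a : ZMod q) := (ZMod.isUnit_iff_coprime a q).mpr haq
  have hφ0 : (0 : ℝ) < q.totient := by exact_mod_cast Nat.totient_pos.mpr (Nat.pos_of_neZero q)
  -- `P₁ = max(q, P₀)`, `P₁^A ≤ x/8`
  set P₁ : ℝ := max (q : ℝ) P₀ with hP₁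
  have hP₁0 : 0 < P₁ := lt_of_lt_of_le hq0 (le_max_left _ _)
  have hP₁1 : 1 ≤ P₁ := hq1.trans (le_max_left _ _)
  have hP₁A : P₁ ^ A ≤ x / 8 := by
    have hle : P₁ ≤ (q : ℝ) * P₀ := by
      rcases le_total (q : ℝ) P₀ with hle | hle
      · rw [hP₁, max_eq_right hle]; exact le_mul_of_one_le_left (by linarith) hq1
      · rw [hP₁, max_eq_left hle]; exact le_mul_of_one_le_right (by linarith) hP₀1
    calc P₁ ^ A ≤ ((q : ℝ) * P₀) ^ A := Real.rpow_le_rpow hP₁0.le hle (by linarith)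
      _ = P₀ ^ A * (q : ℝ) ^ A := by rw [Real.mul_rpow hq0.le (by linarith)]; ring
      _ ≤ x / 8 := by linarith
  -- choice of `P ≥ P₁` with `P^A ≤ x`, `log x ≤ (log P)^2`, and `x/P ≤ x^{1−1/A}`
  obtain ⟨P, hPP₁, hPA, hlogxP, hxP⟩ : ∃ P : ℝ, P₁ ≤ P ∧ P ^ A ≤ (x : ℝ) ∧
      Real.log x ≤ Real.log P ^ 2 ∧ (x : ℝ) / P ≤ (x : ℝ) ^ (1 - 1 / A) := by
    have hxA : (x : ℝ) / (x : ℝ) ^ (1 / A) = (x : ℝ) ^ (1 - 1 / A) := by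
      rw [Real.rpow_sub hx0, Real.rpow_one]
    -- `x/P ≤ x^{1−1/A}` iff `x^{1/A} ≤ P` iff `x ≤ P^A`... we need the OPPOSITE `P^A ≤ x`; so take `P` with
    -- `P^A ≤ x` AND `x^{1/A} ≤ P`, i.e. `P = x^{1/A}` when admissible.
    by_cases hreg : Real.log x ≤ Real.log P₁ ^ 2
    · -- `P = max(P₁, x^{1/A})`: since `P₁^A ≤ x`, `x^{1/A} ≥ P₁`; take `P = x^{1/A}`
      refine ⟨(x : ℝ) ^ (1 / A), ?_, ?_, ?_, ?_⟩
      · have h1 : P₁ ^ A ≤ x := by linarith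
        have := Real.rpow_le_rpow (by positivity) h1 (show (0:ℝ) ≤ 1 / A by positivity)
        rwa [← Real.rpow_mul hP₁0.le, mul_one_div_cancel (by linarith), Real.rpow_one] at this
      · rw [← Real.rpow_mul hx0.le, one_div_mul_cancel (by linarith), Real.rpow_one]
      · refine hreg.trans ?_
        have h1 : Real.log P₁ ≤ Real.log ((x : ℝ) ^ (1 / A)) := by
          refine Real.log_le_log hP₁0 ?_
          have h1 : P₁ ^ A ≤ x := by linarith
          have := Real.rpow_le_rpow (by positivity) h1 (show (0:ℝ) ≤ 1 / A by positivity)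
          rwa [← Real.rpow_mul hP₁0.le, mul_one_div_cancel (by linarith), Real.rpow_one] at this
        have h0 : 0 ≤ Real.log P₁ := Real.log_nonneg hP₁1
        exact pow_le_pow_left₀ h0 h1 2
      · rw [hxA]
    · push Not at hreg
      have hlogx0 : 0 < Real.log x := Real.log_pos (by linarith)
      set u : ℝ := Real.sqrt (Real.log x) with hu
      have hu2 : u ^ 2 = Real.log x := Real.sq_sqrt hlogx0.le
      have hu0 : 0 ≤ u := Real.sqrt_nonneg _
      have hlogP₁ : Real.log P₁ < u := by
        rw [hu, ← Real.sqrt_sq (Real.log_nonneg hP₁1)]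
        exact Real.sqrt_lt_sqrt (sq_nonneg _) hreg
      have hA1u : A + 1 ≤ u := by
        have h1 : A + 1 ≤ Real.log P₀ := by
          rw [← Real.log_exp (A + 1)]; exact Real.log_le_log (Real.exp_pos _) hP₀exp
        have h2 : Real.log P₀ ≤ Real.log P₁ := Real.log_le_log hP₀0 (le_max_right _ _)
        linarith
      -- `P = exp(max u (log x / A))`? We need `P^A ≤ x` i.e. `A log P ≤ log x = u²`, and `x^{1/A} ≤ P`
      -- i.e. `log P ≥ u²/A`. Take `log P = u²/A` (≥ u since u ≥ A): then `(log P)^2 = u⁴/A² ≥ u²` ✓.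
      refine ⟨Real.exp (u ^ 2 / A), ?_, ?_, ?_, ?_⟩
      · rw [← Real.exp_log hP₁0]
        refine Real.exp_le_exp.mpr ?_
        have : u ≤ u ^ 2 / A := by
          rw [le_div_iff₀ (by linarith), sq]
          exact mul_le_mul_of_nonneg_left (by linarith) hu0
        linarith
      · rw [← Real.exp_mul, ← Real.exp_log hx0, Real.exp_le_exp, ← hu2]
        have : u ^ 2 / A * A = u ^ 2 := div_mul_cancel₀ _ (by linarith)
        linarith
      · rw [Real.log_exp, ← hu2]
        have hA0 : (0:ℝ) < A := by linarith
        rw [div_pow, le_div_iff₀ (by positivity)]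
        have : u ^ 2 * A ^ 2 ≤ (u ^ 2) ^ 2 := by
          have h1 : A ≤ u := by linarith
          have h2 : A ^ 2 ≤ u ^ 2 := pow_le_pow_left₀ (by linarith) h1 2
          have h3 := mul_le_mul_of_nonneg_left h2 (sq_nonneg u)
          have e : (u ^ 2) ^ 2 = u ^ 2 * u ^ 2 := by ring
          linarith only [h3, e]
        linarith
      · rw [← hxA]
        refine div_le_div_of_nonneg_left hx0.le (by positivity) ?_
        rw [Real.rpow_def_of_pos hx0, Real.exp_le_exp, ← hu2]
        exact le_of_eq (by ring)
  have hP0 : 0 < P := lt_of_lt_of_le hP₁0 hPP₁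
  have hP₀P : P₀ ≤ P := (le_max_right _ _).trans hPP₁
  have hqP : (q : ℝ) ≤ P := (le_max_left _ _).trans hPP₁
  -- the window `h' = min h ⌊x/2⌋`
  set h' : ℕ := min h (x / 2) with hh'
  have hh'h : h' ≤ h := min_le_left _ _
  have hh'2 : 2 * (h' : ℝ) ≤ x := by
    have h1 : h' ≤ x / 2 := min_le_right _ _
    have h2 : 2 * (x / 2) ≤ x := Nat.mul_div_le x 2
    have : 2 * h' ≤ x := le_trans (Nat.mul_le_mul_left 2 h1) h2
    exact_mod_cast this
  have hδ : (x : ℝ) ^ (1 - 1 / A) ≤ h := hxh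
  -- `N/P = x/P ≤ x^{1−1/A} ≤ h` and `x/P ≤ x/P₁ ≤ x/16`… we need `x/P ≤ h'`; since `P ≥ P₁ ≥ P₀ ≥ e^{A+1} ≥ 4`,
  -- `x/P ≤ x/4 ≤ ⌊x/2⌋` and `x/P ≤ h`.
  have hP3 : (3 : ℝ) ≤ P := by
    have h1 : (3:ℝ) ≤ Real.exp (A + 1) := by
      have := Real.add_one_le_exp (A + 1)
      linarith
    linarith [hP₀exp]
  have hxPh' : (x : ℝ) / P ≤ h' := by
    rcases le_total h (x / 2) with hle | hle
    · rw [hh', min_eq_left hle]; exact hxP.trans hδ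
    · rw [hh', min_eq_right hle]
      have h1 : (x : ℝ) / P ≤ x / 3 := div_le_div_of_nonneg_left hx0.le (by linarith) hP3
      have h2 : (x : ℝ) / 3 ≤ ((x / 2 : ℕ) : ℝ) := by
        have h3 : (x : ℝ) / 2 - 1 ≤ ((x / 2 : ℕ) : ℝ) := by
          have := Nat.div_add_mod x 2
          have h4 : (x : ℝ) = 2 * ((x / 2 : ℕ) : ℝ) + ((x % 2 : ℕ) : ℝ) := by exact_mod_cast this.symm
          have h5 : ((x % 2 : ℕ) : ℝ) ≤ 1 := by exact_mod_cast Nat.lt_succ_iff.mp (Nat.mod_lt x (by norm_num))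
          linarith
        linarith
      exact h1.trans h2
  have hmain := hW q (a : ZMod q) ha P hP₀P hqP x hPA (hlogxP) x h' le_rfl hh'2 hxPh'
  -- compare the windows and the sums
  have hsub : ((Ioc (x - h') x).filter Nat.Prime).filter (fun p : ℕ => (p : ZMod q) = (a : ZMod q)) ⊆
      ((Ioc (x - h) x).filter Nat.Prime).filter (fun p : ℕ => p ≡ a [MOD q]) := by
    intro p hp
    simp only [Finset.mem_filter, Finset.mem_Ioc] at hp ⊢
    refine ⟨⟨⟨by omega, hp.1.1.2⟩, hp.1.2⟩, (ZMod.natCast_eq_natCast_iff _ _ _).mp hp.2⟩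
  have hmono : ∑ p ∈ ((Ioc (x - h') x).filter Nat.Prime).filter (fun p : ℕ => (p : ZMod q) = (a : ZMod q)),
      Real.log p ≤ ∑ p ∈ ((Ioc (x - h) x).filter Nat.Prime).filter (fun p : ℕ => p ≡ a [MOD q]),
        Real.log p := by
    refine Finset.sum_le_sum_of_subset_of_nonneg hsub fun p hp _ => ?_
    have hp' : p.Prime := (Finset.mem_filter.mp (Finset.mem_filter.mp hp).1).2
    exact Real.log_nonneg (by exact_mod_cast hp'.one_lt.le)
  -- `h' ≥ h/3` (if `h ≤ x/2` then `h' = h`; else `h' = ⌊x/2⌋ ≥ x/2 − 1 ≥ x/3 ≥ h/3` as `x ≥ 8`)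
  have hh'3 : (h : ℝ) / 3 ≤ h' := by
    rcases le_total h (x / 2) with hle | hle
    · rw [hh', min_eq_left hle]; linarith [Nat.cast_nonneg (α := ℝ) h]
    · rw [hh', min_eq_right hle]
      have h3 : (x : ℝ) / 2 - 1 ≤ ((x / 2 : ℕ) : ℝ) := by
        have := Nat.div_add_mod x 2
        have h4 : (x : ℝ) = 2 * ((x / 2 : ℕ) : ℝ) + ((x % 2 : ℕ) : ℝ) := by exact_mod_cast this.symm
        have h5 : ((x % 2 : ℕ) : ℝ) ≤ 1 := by exact_mod_cast Nat.lt_succ_iff.mp (Nat.mod_lt x (by norm_num))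
        linarith
      have hhx' : (h : ℝ) ≤ x := by exact_mod_cast hhx
      linarith
  -- assemble: `c/3 · h/(φ q^ε) ≤ c h'/(φ q^{ε'}) ≤ Σ`
  have hqε : (q : ℝ) ^ ε' ≤ (q : ℝ) ^ ε := Real.rpow_le_rpow_of_exponent_le hq1 hε'ε
  have hqε0 : 0 < (q : ℝ) ^ ε' := Real.rpow_pos_of_pos hq0 _
  rw [div_le_iff₀ (mul_pos hφ0 (Real.rpow_pos_of_pos hq0 _))]
  have h1 : c * (h' : ℝ) ≤ (q.totient : ℝ) * (∑ p ∈ ((Ioc (x - h') x).filter Nat.Prime).filter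
      (fun p : ℕ => (p : ZMod q) = (a : ZMod q)), Real.log p) * (q : ℝ) ^ ε' := by
    have := mul_le_mul_of_nonneg_right hmain hqε0.le
    rwa [div_mul_cancel₀ _ hqε0.ne'] at this
  have hS0 : 0 ≤ ∑ p ∈ ((Ioc (x - h) x).filter Nat.Prime).filter (fun p : ℕ => p ≡ a [MOD q]),
      Real.log p := Finset.sum_nonneg fun p hp => by
    have hp' : p.Prime := (Finset.mem_filter.mp (Finset.mem_filter.mp hp).1).2
    exact Real.log_nonneg (by exact_mod_cast hp'.one_lt.le)
  have h2 : (q.totient : ℝ) * (∑ p ∈ ((Ioc (x - h') x).filter Nat.Prime).filter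
      (fun p : ℕ => (p : ZMod q) = (a : ZMod q)), Real.log p) * (q : ℝ) ^ ε' ≤
      (∑ p ∈ ((Ioc (x - h) x).filter Nat.Prime).filter (fun p : ℕ => p ≡ a [MOD q]), Real.log p) *
        (q.totient * (q : ℝ) ^ ε) := by
    calc (q.totient : ℝ) * (∑ p ∈ ((Ioc (x - h') x).filter Nat.Prime).filter
          (fun p : ℕ => (p : ZMod q) = (a : ZMod q)), Real.log p) * (q : ℝ) ^ ε'
        ≤ (q.totient : ℝ) * (∑ p ∈ ((Ioc (x - h) x).filter Nat.Prime).filter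
          (fun p : ℕ => p ≡ a [MOD q]), Real.log p) * (q : ℝ) ^ ε := by
          gcongr
      _ = _ := by ring
  have h3 : c / 3 * (h : ℝ) ≤ c * h' := by
    have := mul_le_mul_of_nonneg_left hh'3 hc.le
    linarith only [this]
  linarith only [h1, h2, h3]

/-- **Primes `≡ a (mod q)` in every short interval** (existence form of
`linnik_gallagher_shortInterval`): there are `L, δ, C₀ > 0` such that for all `q ≥ 1`, `(a, q) = 1`,
all naturals `x ≥ C₀ q^L` and `x^{1−δ} ≤ h ≤ x`, some prime `p ≡ a (mod q)` lies in `(x − h, x]`.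
[cite: Gallagher1970Density, Theorem 7] -/
theorem exists_prime_modEq_mem_shortInterval :
    ∃ L δ C₀ : ℝ, 0 < L ∧ 0 < δ ∧ 0 < C₀ ∧ ∀ q : ℕ, 1 ≤ q → ∀ a : ℕ, a.Coprime q →
      ∀ x h : ℕ, C₀ * (q : ℝ) ^ L ≤ x → (x : ℝ) ^ (1 - δ) ≤ h → h ≤ x →
        ∃ p : ℕ, p.Prime ∧ p ≡ a [MOD q] ∧ x - h < p ∧ p ≤ x := by
  classical
  obtain ⟨L, δ, C₀, c, hL, hδ, hC₀, hc, hmain⟩ := linnik_gallagher_shortInterval one_pos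
  refine ⟨L, δ, C₀, hL, hδ, hC₀, fun q hq a haq x h hx hxh hhx => ?_⟩
  have hq0 : (0 : ℝ) < q := by exact_mod_cast hq
  have hqL : 1 ≤ (q : ℝ) ^ L := Real.one_le_rpow (by exact_mod_cast hq) hL.le
  have hx0 : (0 : ℝ) < x := lt_of_lt_of_le (mul_pos hC₀ (Real.rpow_pos_of_pos hq0 _)) hx
  have hh0 : (0 : ℝ) < h := lt_of_lt_of_le (Real.rpow_pos_of_pos hx0 _) hxh
  have hφ0 : (0 : ℝ) < q.totient := by exact_mod_cast Nat.totient_pos.mpr (by omega)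
  have hpos : 0 < ∑ p ∈ ((Ioc (x - h) x).filter Nat.Prime).filter (fun p : ℕ => p ≡ a [MOD q]),
      Real.log p :=
    lt_of_lt_of_le (by positivity) (hmain q hq a haq x h hx hxh hhx)
  have hne : (((Ioc (x - h) x).filter Nat.Prime).filter (fun p : ℕ => p ≡ a [MOD q])).Nonempty := by
    by_contra hemp
    rw [Finset.not_nonempty_iff_eq_empty] at hemp
    rw [hemp, Finset.sum_empty] at hpos
    exact lt_irrefl _ hpos
  obtain ⟨p, hp⟩ := hne
  simp only [Finset.mem_filter, Finset.mem_Ioc] at hp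
  exact ⟨p, hp.1.2, hp.2, hp.1.1.1, hp.1.1.2⟩

end Literature.NumberTheory.Sieve

end
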